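import Literature.Geometry.Riemannian.RicciFlowHeatKernelFn
import Literature.Geometry.Riemannian.HeatKernelDuality
import Literature.Geometry.Riemannian.KernelNashEntropyJensen
import Mathlib.Analysis.Convex.Integral
import Mathlib.Analysis.SpecialFunctions.Log.NegMulLog
import Mathlib.MeasureTheory.Integral.Prod
import HarnessLib

/-!
# The entropy of a backward conjugate heat flow dominates the averaged kernel Nash entropy
# (Jensen; Bamler 2020a, §6, proof of Thm. 6.1)

R. Bamler, *Entropy and heat kernel bounds on a Ricci flow background*, arXiv:2008.07093 (2020a),
§6, proof of Thm. 6.1 (the Jensen step): let `K(x,t;y,s)` be the heat kernel of a Ricci flow on a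
closed manifold `Mᵐ`, `s < t`, let `ψ > 0` be a smooth probability density for `dg_t` and let `v`
be the backward conjugate heat flow (`□*v = 0` on `M × [s, t]`) with `v(t) = ψ`. Then

  `v(s, y) = ∫ K(x,t;y,s) ψ(x) dg_t(x)`                                   (representation),

and Jensen's inequality for the convex `u ↦ u log u` and the probability measure `ψ dg_t` gives
`v log v (s, y) ≤ ∫ (K log K)(x,t;y,s) ψ(x) dg_t(x)`; integrating over `dg_s(y)` (Fubini) and using
`𝒩*_s(x,t) = −∫ K log K dg_s − (m/2) log(4π(t − s)) − m/2` (`IsRicciFlow.kernelNashEntropy_eq`):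

  `∫ ψ(x) 𝒩*_s(x,t) dg_t(x) + (m/2) log(4π(t − s)) + m/2 ≤ −∫ v log v (s, ·) dg_s`.

* `isProbabilityMeasure_withDensity_ofReal`, `integral_withDensity_ofReal_eq` — the probability
  measure `ψ dμ` of a non-negative density of unit mass and integration against it;
* `IsRicciFlow.continuous_integral_mul_heatKernelFn` — `y ↦ ∫ ψ(x) K(x,t;y,s) dg_t(x)` is
  continuous;
* `IsRicciFlow.integral_mul_conjugateHeat_eq_integral_mul_integral` — the weak form of the
  representation formula, `∫ φ v(s) dg_s = ∫ φ(y) (∫ ψ K(·,t;y,s) dg_t) dg_s(y)` for continuous `φ`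
  (pairing identity `IsRicciFlow.integral_heatValueC_mul_eq`, density formula, Fubini);
* `IsRicciFlow.conjugateHeat_eq_integral_mul_heatKernelFn` — **the representation formula**
  `v(s, y) = ∫ ψ(x) K(x,t;y,s) dg_t(x)` for every `y`;
* `IsRicciFlow.integral_mul_negMulLog_heatKernelFn_le` — the pointwise Jensen step;
* `integral_mul_pointedNashEntropy_le_neg_integral_mul_log` — **the inequality above**, for a
  Ricci flow `hflow = (h, cov)` on `[a, T]` of a `C^∞` family of Riemannian metrics on a closed
  connected manifold `M` (modelled on `ℝᵐ`), `a < s < t ≤ T`.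

Everything is proved; no definitions, no named facts.

## References

* R. H. Bamler, *Entropy and heat kernel bounds on a Ricci flow background*, arXiv:2008.07093
  (2020), §2.3 (duality, `dν_{x,t;s} = K(x,t;·,s) dg_s`), §5.1 Def. 5.1, §6, proof of Thm. 6.1.
  [Bamler2020Entropy]
-/

noncomputable section

open Set Filter Function MeasureTheory Measure
open scoped Manifold ContDiff Topology ENNReal NNReal

namespace Literature.Geometry.Riemannian

open Lorentzian Lorentzian.PseudoRiemannianMetric

/-! ### The probability measure `ψ dμ` -/

section Density

variable {α : Type*} [MeasurableSpace α] {μ : Measure α}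

/-- For an integrable `ψ ≥ 0` with `∫ ψ dμ = 1`, `ψ dμ` is a probability measure. [folklore] -/
theorem isProbabilityMeasure_withDensity_ofReal {ψ : α → ℝ} (hψi : Integrable ψ μ)
    (hψ0 : 0 ≤ᵐ[μ] ψ) (hψ1 : ∫ x, ψ x ∂μ = 1) :
    IsProbabilityMeasure (μ.withDensity fun x ↦ ENNReal.ofReal (ψ x)) := by
  refine ⟨?_⟩
  rw [withDensity_apply _ MeasurableSet.univ, Measure.restrict_univ,
    ← ofReal_integral_eq_lintegral_ofReal hψi hψ0, hψ1, ENNReal.ofReal_one]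

/-- Integration against `ψ dμ` for a measurable `ψ ≥ 0`: `∫ f d(ψμ) = ∫ ψ f dμ`. [folklore] -/
theorem integral_withDensity_ofReal_eq {ψ : α → ℝ} (hψm : Measurable ψ) (hψ0 : ∀ x, 0 ≤ ψ x)
    (f : α → ℝ) :
    ∫ x, f x ∂(μ.withDensity fun x ↦ ENNReal.ofReal (ψ x)) = ∫ x, ψ x * f x ∂μ := by
  rw [integral_withDensity_eq_integral_toReal_smul hψm.ennreal_ofReal
    (Eventually.of_forall fun _ ↦ ENNReal.ofReal_lt_top)]
  refine integral_congr_ae (Eventually.of_forall fun x ↦ ?_)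
  simp only [ENNReal.toReal_ofReal (hψ0 x), smul_eq_mul]

end Density

/-! ### The representation formula and the Jensen step -/

section Jensen

variable {m : ℕ} {H : Type*} [TopologicalSpace H]
  {I : ModelWithCorners ℝ (EuclideanSpace ℝ (Fin m)) H} [I.Boundaryless]
  {M : Type*} [TopologicalSpace M] [ChartedSpace H M] [IsManifold I ∞ M]
  [T2Space M] [CompactSpace M] [SecondCountableTopology M] [MeasurableSpace M] [BorelSpace M]
  [ConnectedSpace M]
  {h : ℝ → PseudoRiemannianMetric I ∞ (EuclideanSpace ℝ (Fin m)) (TangentSpace I : M → Type _)}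
  {cov : ℝ → CovariantDerivative I (EuclideanSpace ℝ (Fin m)) (TangentSpace I : M → Type _)}
  {a T : ℝ} (hflow : IsRicciFlow h cov (Icc a T)) (hh : IsContMDiffFamilyOn ∞ h univ)
  (hR : ∀ r, (h r).IsRiemannian)

/-- **Continuity of `y ↦ ∫ ψ(x) K(x,t;y,s) dg_t(x)`** for continuous `ψ` and `a < s < t ≤ T`
(the integrand is jointly continuous on the compact `M × M`). [cite: Bamler2020Entropy, §2.3] -/
theorem IsRicciFlow.continuous_integral_mul_heatKernelFn {s t : ℝ} (has : a < s) (hst : s < t)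
    (htT : t ≤ T) {ψ : M → ℝ} (hψc : Continuous ψ) :
    Continuous fun y ↦ ∫ x, ψ x * hflow.heatKernelFn hh hR t x (y, s) ∂(h t).riemVolume := by
  haveI : TopologicalSpace.MetrizableSpace M := Manifold.metrizableSpace I M
  haveI : IsFiniteMeasure (h t).riemVolume := ⟨(h t).riemVolume_univ_lt_top⟩
  have ht : t ∈ Ioc a T := ⟨has.trans hst, htT⟩
  have hs : s ∈ Ioo a t := ⟨has, hst⟩
  have hKc : Continuous (uncurry fun y x ↦ ψ x * hflow.heatKernelFn hh hR t x (y, s)) :=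
    (hψc.comp continuous_snd).mul
      ((hflow.continuous_heatKernelFn_basePoint_target hh hR ht hs).comp continuous_swap)
  have h1 := continuous_parametric_integral_of_continuous (μ := (h t).riemVolume) hKc
    isCompact_univ
  simpa only [Measure.restrict_univ] using h1

/-- **The representation formula, weak form**: for a Ricci flow on `[a, T]`, `a < s < t ≤ T`, a
smooth `ψ`, the conjugate heat solution `v` on `M × [s, t]` with `v(t) = ψ`, and every continuous
test function `φ`,
`∫ φ(y) v(s, y) dg_s(y) = ∫ φ(y) (∫ ψ(x) K(x,t;y,s) dg_t(x)) dg_s(y)`: the pairing identity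
`∫ φ v(s) dg_s = ∫ (∫ φ dν_{x,t;s}) v(t,x) dg_t(x)` (duality, `IsRicciFlow.integral_heatValueC_mul_eq`),
`dν_{x,t;s} = K(x,t;·,s) dg_s` and Fubini on `M × M`. [cite: Bamler2020Entropy, §2.3] -/
theorem IsRicciFlow.integral_mul_conjugateHeat_eq_integral_mul_integral {s t : ℝ} (has : a < s)
    (hst : s < t) (htT : t ≤ T) {ψ : M → ℝ} (hψ : ContMDiff I 𝓘(ℝ, ℝ) ∞ ψ) {v : ℝ → M → ℝ}
    (hv : IsConjugateHeatSolutionOn h cov (Icc s t) v) (hvt : v t = ψ) {φ : M → ℝ}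
    (hφ : Continuous φ) :
    ∫ y, φ y * v s y ∂(h s).riemVolume =
      ∫ y, φ y * (∫ x, ψ x * hflow.heatKernelFn hh hR t x (y, s) ∂(h t).riemVolume)
        ∂(h s).riemVolume := by
  have ht : t ∈ Ioc a T := ⟨has.trans hst, htT⟩
  have hs : s ∈ Ioo a t := ⟨has, hst⟩
  haveI : IsFiniteMeasure (h t).riemVolume := ⟨(h t).riemVolume_univ_lt_top⟩
  haveI : IsFiniteMeasure (h s).riemVolume := ⟨(h s).riemVolume_univ_lt_top⟩
  have hψc : Continuous ψ := hψ.continuous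
  -- the pairing identity, with `∫ φ dν_{x,t;s} = ∫ φ K(x,t;·,s) dg_s`
  have h1 := (hflow.mono (Icc_subset_Icc has.le htT)).integral_heatValueC_mul_eq hh hR hst hφ hv
  have h2 : ∀ x, heatValueC h s t x φ =
      ∫ y, φ y * hflow.heatKernelFn hh hR t x (y, s) ∂(h s).riemVolume := fun x ↦ by
    rw [← integral_heatKernelMeasure hh hR hst x hφ,
      hflow.integral_heatKernelMeasure_eq_integral_mul_heatKernelFn hh hR ht x hs φ]
  rw [← h1, hvt]
  simp_rw [h2]
  -- Fubini
  have hF : Continuous (uncurry fun x y ↦ ψ x * (φ y * hflow.heatKernelFn hh hR t x (y, s))) :=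
    (hψc.comp continuous_fst).mul ((hφ.comp continuous_snd).mul
      (hflow.continuous_heatKernelFn_basePoint_target hh hR ht hs))
  have hFi : Integrable (uncurry fun x y ↦ ψ x * (φ y * hflow.heatKernelFn hh hR t x (y, s)))
      ((h t).riemVolume.prod (h s).riemVolume) :=
    hF.integrable_of_hasCompactSupport (HasCompactSupport.of_compactSpace _)
  calc ∫ x, (∫ y, φ y * hflow.heatKernelFn hh hR t x (y, s) ∂(h s).riemVolume) * ψ x
          ∂(h t).riemVolume
      = ∫ x, ∫ y, ψ x * (φ y * hflow.heatKernelFn hh hR t x (y, s)) ∂(h s).riemVolume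
          ∂(h t).riemVolume := by
        refine integral_congr_ae (Eventually.of_forall fun x ↦ ?_)
        beta_reduce
        rw [mul_comm, ← integral_const_mul]
    _ = ∫ y, ∫ x, ψ x * (φ y * hflow.heatKernelFn hh hR t x (y, s)) ∂(h t).riemVolume
          ∂(h s).riemVolume := integral_integral_swap hFi
    _ = ∫ y, φ y * (∫ x, ψ x * hflow.heatKernelFn hh hR t x (y, s) ∂(h t).riemVolume)
          ∂(h s).riemVolume := by
        refine integral_congr_ae (Eventually.of_forall fun y ↦ ?_)
        simp only [← integral_const_mul]
        refine integral_congr_ae (Eventually.of_forall fun x ↦ ?_)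
        ring

/-- **The representation formula for backward conjugate heat flows** (Bamler 2020a, §2.3:
`v(s, y) = ∫ K(x,t;y,s) v(t,x) dg_t(x)` for `□*v = 0`): for a Ricci flow on `[a, T]`,
`a < s < t ≤ T`, a smooth `ψ` and the conjugate heat solution `v` on `M × [s, t]` with `v(t) = ψ`,
`v(s, y) = ∫ ψ(x) K(x,t;y,s) dg_t(x)` for every `y` (the weak form tested against
`φ = v(s) − ∫ ψ K dg_t`, continuity of both sides and positivity of `dg_s` on open sets).
[cite: Bamler2020Entropy, §2.3] -/
theorem IsRicciFlow.conjugateHeat_eq_integral_mul_heatKernelFn {s t : ℝ} (has : a < s)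
    (hst : s < t) (htT : t ≤ T) {ψ : M → ℝ} (hψ : ContMDiff I 𝓘(ℝ, ℝ) ∞ ψ) {v : ℝ → M → ℝ}
    (hv : IsConjugateHeatSolutionOn h cov (Icc s t) v) (hvt : v t = ψ) (y : M) :
    v s y = ∫ x, ψ x * hflow.heatKernelFn hh hR t x (y, s) ∂(h t).riemVolume := by
  haveI : IsFiniteMeasure (h s).riemVolume := ⟨(h s).riemVolume_univ_lt_top⟩
  set w : M → ℝ := fun y ↦ ∫ x, ψ x * hflow.heatKernelFn hh hR t x (y, s) ∂(h t).riemVolume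
    with hw
  have hvs : Continuous (v s) :=
    (contMDiff_slice_of_contMDiffOn hv.1 ⟨le_rfl, hst.le⟩).continuous
  have hwc : Continuous w := hflow.continuous_integral_mul_heatKernelFn hh hR has hst htT hψ.continuous
  have hweak : ∀ {φ : M → ℝ}, Continuous φ →
      ∫ y, φ y * v s y ∂(h s).riemVolume = ∫ y, φ y * w y ∂(h s).riemVolume := fun hφ ↦
    hflow.integral_mul_conjugateHeat_eq_integral_mul_integral hh hR has hst htT hψ hv hvt hφ
  have hi : ∀ {f : M → ℝ}, Continuous f → Integrable f (h s).riemVolume := fun hf ↦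
    hf.integrable_of_hasCompactSupport (HasCompactSupport.of_compactSpace _)
  have hdc : Continuous fun y ↦ v s y - w y := hvs.sub hwc
  -- `∫ (v(s) − w)² dg_s = 0`
  have h0 : ∫ y, (v s y - w y) * (v s y - w y) ∂(h s).riemVolume = 0 := by
    have e : (fun y ↦ (v s y - w y) * (v s y - w y)) =
        fun y ↦ (v s y - w y) * v s y - (v s y - w y) * w y := by
      funext y
      ring
    have hi1 : Integrable (fun y ↦ (v s y - w y) * v s y) (h s).riemVolume := hi (hdc.mul hvs)
    have hi2 : Integrable (fun y ↦ (v s y - w y) * w y) (h s).riemVolume := hi (hdc.mul hwc)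
    rw [e, integral_sub hi1 hi2, hweak hdc, sub_self]
  have hi3 : Integrable (fun y ↦ (v s y - w y) * (v s y - w y)) (h s).riemVolume :=
    hi (hdc.mul hdc)
  have hae : (fun y ↦ (v s y - w y) * (v s y - w y)) =ᵐ[(h s).riemVolume] 0 :=
    (integral_eq_zero_iff_of_nonneg (fun y ↦ mul_self_nonneg _) hi3).1 h0
  have hae' : v s =ᵐ[(h s).riemVolume] w := by
    filter_upwards [hae] with y hy
    exact sub_eq_zero.1 (mul_self_eq_zero.1 hy)
  -- continuity and positivity of `dg_s` on open sets
  haveI : (h s).riemVolume.IsOpenPosMeasure := by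
    rw [riemVolume_eq (hR s)]
    exact isOpenPosMeasure_riemannianMeasure _
  exact congrFun (Measure.eq_of_ae_eq hae' hvs hwc) y

/-- **Jensen for the averaged kernel entropy**: for `a < s < t ≤ T`, a continuous probability
density `ψ ≥ 0` for `dg_t` and every `y`,
`∫ ψ(x) Λ(K(x,t;y,s)) dg_t(x) ≤ Λ(∫ ψ(x) K(x,t;y,s) dg_t(x))`, `Λ(u) = −u log u` concave on
`[0, ∞)` (`ConcaveOn.le_map_integral` for the probability measure `ψ dg_t`).
[cite: Bamler2020Entropy, §6, proof of Thm. 6.1] -/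
theorem IsRicciFlow.integral_mul_negMulLog_heatKernelFn_le {s t : ℝ} (has : a < s) (hst : s < t)
    (htT : t ≤ T) {ψ : M → ℝ} (hψc : Continuous ψ) (hψ0 : ∀ x, 0 ≤ ψ x)
    (hψ1 : ∫ x, ψ x ∂(h t).riemVolume = 1) (y : M) :
    ∫ x, ψ x * Real.negMulLog (hflow.heatKernelFn hh hR t x (y, s)) ∂(h t).riemVolume ≤
      Real.negMulLog (∫ x, ψ x * hflow.heatKernelFn hh hR t x (y, s) ∂(h t).riemVolume) := by
  have ht : t ∈ Ioc a T := ⟨has.trans hst, htT⟩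
  have hs : s ∈ Ioo a t := ⟨has, hst⟩
  haveI : IsFiniteMeasure (h t).riemVolume := ⟨(h t).riemVolume_univ_lt_top⟩
  have hψi : Integrable ψ (h t).riemVolume :=
    hψc.integrable_of_hasCompactSupport (HasCompactSupport.of_compactSpace _)
  haveI : IsProbabilityMeasure ((h t).riemVolume.withDensity fun x ↦ ENNReal.ofReal (ψ x)) :=
    isProbabilityMeasure_withDensity_ofReal hψi (Eventually.of_forall hψ0) hψ1
  have hKc : Continuous fun x ↦ hflow.heatKernelFn hh hR t x (y, s) :=
    (hflow.continuous_heatKernelFn_basePoint_target hh hR ht hs).comp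
      (continuous_id.prodMk continuous_const)
  have hKi : Integrable (fun x ↦ hflow.heatKernelFn hh hR t x (y, s))
      ((h t).riemVolume.withDensity fun x ↦ ENNReal.ofReal (ψ x)) :=
    hKc.integrable_of_hasCompactSupport (HasCompactSupport.of_compactSpace _)
  have hΛi : Integrable (Real.negMulLog ∘ fun x ↦ hflow.heatKernelFn hh hR t x (y, s))
      ((h t).riemVolume.withDensity fun x ↦ ENNReal.ofReal (ψ x)) :=
    (Real.continuous_negMulLog.comp hKc).integrable_of_hasCompactSupport
      (HasCompactSupport.of_compactSpace _)
  have hJ := Real.concaveOn_negMulLog.le_map_integral Real.continuous_negMulLog.continuousOn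
    isClosed_Ici (Eventually.of_forall fun x ↦
      (hflow.heatKernelFn_pos hh hR ht x ⟨mem_univ _, hs⟩).le) hKi hΛi
  rwa [integral_withDensity_ofReal_eq hψc.measurable hψ0,
    integral_withDensity_ofReal_eq hψc.measurable hψ0] at hJ

/-- **The entropy of a backward conjugate heat flow dominates the averaged kernel Nash entropy**
(Bamler 2020a, §6, proof of Thm. 6.1, the Jensen step): for a Ricci flow on a closed connected
manifold `Mᵐ`, `a < s < t ≤ T`, a smooth positive probability density `ψ` for `dg_t` and the
conjugate heat solution `v` on `M × [s, t]` with `v(t) = ψ`,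
`∫ ψ(x) 𝒩*_s(x,t) dg_t(x) + (m/2) log(4π(t − s)) + m/2 ≤ −∫ v log v (s, ·) dg_s`.
Proof: `v(s, y) = ∫ ψ(x) K(x,t;y,s) dg_t(x)` (`IsRicciFlow.conjugateHeat_eq_integral_mul_heatKernelFn`),
Jensen `∫ ψ Λ(K(·,t;y,s)) dg_t ≤ Λ(v(s,y))` with `Λ(u) = −u log u`, integration over `dg_s(y)` and
Fubini, and `𝒩*_s(x,t) = ∫ Λ(K(x,t;·,s)) dg_s − (m/2) log(4π(t−s)) − m/2`
(`IsRicciFlow.kernelNashEntropy_eq`) together with `∫ ψ dg_t = 1`.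
[cite: Bamler2020Entropy, §6, proof of Thm. 6.1] -/
theorem integral_mul_pointedNashEntropy_le_neg_integral_mul_log {s t : ℝ} (has : a < s)
    (hst : s < t) (htT : t ≤ T) {ψ : M → ℝ} (hψ : ContMDiff I 𝓘(ℝ, ℝ) ∞ ψ)
    (hψ0 : ∀ x, 0 < ψ x) (hψ1 : ∫ x, ψ x ∂(h t).riemVolume = 1) {v : ℝ → M → ℝ}
    (hv : IsConjugateHeatSolutionOn h cov (Icc s t) v) (hvt : v t = ψ) :
    ∫ x, ψ x * pointedNashEntropy h (fun r w ↦ hflow.heatKernelFn hh hR t x (w, r)) m t s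
        ∂(h t).riemVolume + (m : ℝ) / 2 * Real.log (4 * Real.pi * (t - s)) + (m : ℝ) / 2 ≤
      -∫ y, v s y * Real.log (v s y) ∂(h s).riemVolume := by
  have ht : t ∈ Ioc a T := ⟨has.trans hst, htT⟩
  have hs : s ∈ Ioo a t := ⟨has, hst⟩
  haveI : IsFiniteMeasure (h t).riemVolume := ⟨(h t).riemVolume_univ_lt_top⟩
  haveI : IsFiniteMeasure (h s).riemVolume := ⟨(h s).riemVolume_univ_lt_top⟩
  set K : M → M → ℝ := fun x y ↦ hflow.heatKernelFn hh hR t x (y, s) with hK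
  set c : ℝ := (m : ℝ) / 2 * Real.log (4 * Real.pi * (t - s)) + (m : ℝ) / 2 with hc
  have hψc : Continuous ψ := hψ.continuous
  have hψi : Integrable ψ (h t).riemVolume :=
    hψc.integrable_of_hasCompactSupport (HasCompactSupport.of_compactSpace _)
  have hvs : Continuous (v s) :=
    (contMDiff_slice_of_contMDiffOn hv.1 ⟨le_rfl, hst.le⟩).continuous
  -- the explicit form of the kernel Nash entropy
  have hN : ∀ x, pointedNashEntropy h (fun r w ↦ hflow.heatKernelFn hh hR t x (w, r)) m t s =
      ∫ y, Real.negMulLog (K x y) ∂(h s).riemVolume - c := fun x ↦ by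
    rw [hflow.kernelNashEntropy_eq hh hR ht x hs, hc]
    simp only [Real.negMulLog, neg_mul, hK]
    ring
  -- the representation formula
  have hrep : ∀ y, v s y = ∫ x, ψ x * K x y ∂(h t).riemVolume := fun y ↦
    hflow.conjugateHeat_eq_integral_mul_heatKernelFn hh hR has hst htT hψ hv hvt y
  -- joint continuity and integrability on `M × M`
  have hKc : Continuous (uncurry K) := hflow.continuous_heatKernelFn_basePoint_target hh hR ht hs
  have hF : Continuous (uncurry fun x y ↦ ψ x * Real.negMulLog (K x y)) :=
    (hψc.comp continuous_fst).mul (Real.continuous_negMulLog.comp hKc)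
  have hFi : Integrable (uncurry fun x y ↦ ψ x * Real.negMulLog (K x y))
      ((h t).riemVolume.prod (h s).riemVolume) :=
    hF.integrable_of_hasCompactSupport (HasCompactSupport.of_compactSpace _)
  have hSi : Integrable (fun x ↦ ∫ y, ψ x * Real.negMulLog (K x y) ∂(h s).riemVolume)
      (h t).riemVolume := hFi.integral_prod_left
  have hTi : Integrable (fun y ↦ ∫ x, ψ x * Real.negMulLog (K x y) ∂(h t).riemVolume)
      (h s).riemVolume := hFi.integral_prod_right
  have hΛv : Integrable (fun y ↦ Real.negMulLog (v s y)) (h s).riemVolume :=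
    (Real.continuous_negMulLog.comp hvs).integrable_of_hasCompactSupport
      (HasCompactSupport.of_compactSpace _)
  -- Jensen, pointwise in `y`, integrated over `y`, and Fubini
  have hJ : ∀ y, ∫ x, ψ x * Real.negMulLog (K x y) ∂(h t).riemVolume ≤ Real.negMulLog (v s y) :=
    fun y ↦ by
    rw [hrep y]
    exact hflow.integral_mul_negMulLog_heatKernelFn_le hh hR has hst htT hψc (fun x ↦ (hψ0 x).le)
      hψ1 y
  have hmain : ∫ x, (∫ y, ψ x * Real.negMulLog (K x y) ∂(h s).riemVolume) ∂(h t).riemVolume ≤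
      ∫ y, Real.negMulLog (v s y) ∂(h s).riemVolume := by
    rw [integral_integral_swap hFi]
    exact integral_mono hTi hΛv hJ
  -- bookkeeping
  have hL : ∫ x, ψ x * pointedNashEntropy h (fun r w ↦ hflow.heatKernelFn hh hR t x (w, r)) m t s
      ∂(h t).riemVolume =
      ∫ x, (∫ y, ψ x * Real.negMulLog (K x y) ∂(h s).riemVolume) ∂(h t).riemVolume - c := by
    simp_rw [hN]
    have e : (fun x ↦ ψ x * (∫ y, Real.negMulLog (K x y) ∂(h s).riemVolume - c)) =
        fun x ↦ (∫ y, ψ x * Real.negMulLog (K x y) ∂(h s).riemVolume) - c * ψ x := by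
      funext x
      rw [mul_sub, ← integral_const_mul, mul_comm (ψ x) c]
    rw [e, integral_sub hSi (hψi.const_mul c), integral_const_mul, hψ1, mul_one]
  have hRHS : -∫ y, v s y * Real.log (v s y) ∂(h s).riemVolume =
      ∫ y, Real.negMulLog (v s y) ∂(h s).riemVolume := by
    rw [← integral_neg]
    simp only [Real.negMulLog, neg_mul]
  rw [hL, hRHS, hc]
  linarith [hmain]

end Jensen

end Literature.Geometry.Riemannian

end
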